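import Summits.RiemannHypothesis.RiemannHypothesis.Theorems.NymanBeurlingTailKernel

/-!
# (RH-FREE) Nyman–Beurling tail route, kernel B: the key orthogonality `⟨ρ_{k+1}, q⟩ = Q/(k+1)` (item `NbKeyOrthogonality`),
the first normal equation on Nyman's interval (item `NbFirstNormalEquation`), the Assembly, and the RUNG LEAF
`NbTheory.NbTailConstIdentity` — RH-FREE (per `N`, for every solution of the normal equations)

RH-FREE (per `N`). Nothing here bears on the truth of RH: exact identities of finite-`N` linear algebra and Lebesgue
integrals on `(0,1]`; no convergence or rate statement about `d_N` is made or used.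

To land as `Summits/RiemannHypothesis/RiemannHypothesis/Theorems/NymanBeurlingTailLeaf.lean` (after kernel A's olean):
`nbKeyOrthogonality_holds : NbKeyOrthogonality` (K1a `dilateFract_holds`: `ρ_{k+1} = ρ_1/(k+1) + {⌊1/x⌋/(k+1)}` on `(0,1]`
by Euclidean division of `⌊1/x⌋`; K1b `⟨ρ_1,q⟩ = Q`; K1c steps ⊥ q), `nbFirstNormalEquation_holds : NbFirstNormalEquation`
(`G_{0j} = G⁰_{0j} + 1/(j+1)` by `setIntegral_union` + `integral_Ioi_rpow_of_lt`), `assembly_proof : Assembly`,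
`nbTailConstIdentity_holds : NbTailConstIdentity` (axioms propext / Classical.choice / Quot.sound).
Cell rh-li, theory seat rh-li-theory gen 4 (proof sketch, farm rc 0 inline: HOME/theory/route/nb/LeafNB.lean); the prover files it.
-/

noncomputable section

set_option linter.dupNamespace false

namespace Summit.RiemannHypothesis.RiemannHypothesis.Theorems.NbTheory

open MeasureTheory Set
open Literature.NumberTheory.LFunctions Literature.NumberTheory.LFunctions.BaezDuarteOnlyIf

/-! ## K1a — the dilate splits as `ρ_1/(k+1)` + an `I_n`-step (Euclidean division of `⌊1/x⌋`) -/

/-- K1a (Euclidean division of `⌊1/x⌋`): on `(0,1]`, `ρ_{k+1} = ρ_1/(k+1) + {⌊1/x⌋/(k+1)}`. -/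
theorem dilateFract_holds (k : ℕ) (x : ℝ) (hx : x ∈ Set.Ioc (0 : ℝ) 1) :
    nbRho k x = Int.fract (1 / x) / ((k : ℝ) + 1) + Int.fract ((⌊1 / x⌋₊ : ℝ) / ((k : ℝ) + 1)) := by
  obtain ⟨hx0, hx1⟩ := hx
  have hK : (0 : ℝ) < (k : ℝ) + 1 := by positivity
  have hy0 : (0 : ℝ) ≤ 1 / x := by positivity
  have hfl : ((⌊1 / x⌋₊ : ℕ) : ℝ) = ((⌊1 / x⌋ : ℤ) : ℝ) := by
    exact_mod_cast Int.natCast_floor_eq_floor hy0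
  set n : ℕ := ⌊1 / x⌋₊ with hn
  obtain ⟨a, r, hr, hnar⟩ : ∃ a r : ℕ, r < k + 1 ∧ n = (k + 1) * a + r :=
    ⟨n / (k + 1), n % (k + 1), Nat.mod_lt _ (Nat.succ_pos k), (Nat.div_add_mod n (k + 1)).symm⟩
  have hf0 : 0 ≤ Int.fract (1 / x) := Int.fract_nonneg _
  have hf1 : Int.fract (1 / x) < 1 := Int.fract_lt_one _
  have hfdef : Int.fract (1 / x) = 1 / x - (n : ℝ) := by
    rw [hfl, Int.self_sub_floor]
  have hr' : (r : ℝ) < (k : ℝ) + 1 := by exact_mod_cast hr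
  have hnR : (n : ℝ) = ((k : ℝ) + 1) * a + r := by
    rw [hnar]; push_cast; ring
  have h2 : Int.fract ((n : ℝ) / ((k : ℝ) + 1)) = r / ((k : ℝ) + 1) := by
    rw [Int.fract_eq_iff]
    refine ⟨by positivity, by rw [div_lt_one hK]; exact hr', (a : ℤ), ?_⟩
    rw [hnR]; push_cast; field_simp; ring
  have h1 : Int.fract (1 / (((k : ℝ) + 1) * x)) = (r + Int.fract (1 / x)) / ((k : ℝ) + 1) := by
    rw [Int.fract_eq_iff]
    refine ⟨by positivity, ?_, (a : ℤ), ?_⟩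
    · rw [div_lt_one hK]
      have : (r : ℝ) + 1 ≤ (k : ℝ) + 1 := by exact_mod_cast hr
      linarith
    · rw [hfdef, hnR]; push_cast; field_simp; ring
  show Int.fract (1 / (((k : ℝ) + 1) * x)) = _
  rw [h1, h2]; field_simp; ring

/-! ## K1 — KEY ORTHOGONALITY `⟨ρ_{k+1}, q⟩ = Q/(k+1)` (route item `NbKeyOrthogonality`, PROVED) -/

/-- **Item `NbKeyOrthogonality` (crux): `⟨ρ_{k+1}, q⟩_{(0,1]} = Q/(k+1)`.** -/
theorem nbKeyOrthogonality_holds :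
    (∀ k : ℕ, ∫ x in Set.Ioc (0 : ℝ) 1,
      Summit.RiemannHypothesis.RiemannHypothesis.Theorems.NbTheory.nbRho k x *
        Summit.RiemannHypothesis.RiemannHypothesis.Theorems.NbTheory.nbFluct x =
    Summit.RiemannHypothesis.RiemannHypothesis.Theorems.NbTheory.nbQ / ((k : ℝ) + 1)) := by
  intro k
  have hk : (0 : ℝ) < (k : ℝ) + 1 := by positivity
  have i1 : IntegrableOn (fun x : ℝ ↦ Int.fract (1 / x) * nbFluct x) (Set.Ioc (0 : ℝ) 1) := by
    refine integrableOn_Ioc_of_bounded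
      ((measurable_fract.comp (by fun_prop : Measurable fun x : ℝ ↦ 1 / x)).mul measurable_nbFluct) (M := 2)
      fun x ↦ ?_
    rw [abs_mul, abs_of_nonneg (Int.fract_nonneg _)]
    have h1 : Int.fract (1 / x) ≤ 1 := (Int.fract_lt_one _).le
    have h2 := abs_nbFluct_le x
    nlinarith [Int.fract_nonneg (1 / x), abs_nonneg (nbFluct x)]
  have i2 : IntegrableOn (fun x : ℝ ↦ Int.fract ((⌊1 / x⌋₊ : ℝ) / ((k : ℝ) + 1)) * nbFluct x) (Set.Ioc (0 : ℝ) 1) := by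
    have hm : Measurable fun x : ℝ ↦ Int.fract ((⌊1 / x⌋₊ : ℝ) / ((k : ℝ) + 1)) :=
      measurable_fract.comp (((measurable_from_nat (f := fun n : ℕ ↦ (n : ℝ))).comp
        (Nat.measurable_floor.comp (by fun_prop : Measurable fun x : ℝ ↦ 1 / x))).div_const _)
    refine integrableOn_Ioc_of_bounded (hm.mul measurable_nbFluct) (M := 2) fun x ↦ ?_
    rw [abs_mul, abs_of_nonneg (Int.fract_nonneg _)]
    have h1 : Int.fract ((⌊1 / x⌋₊ : ℝ) / ((k : ℝ) + 1)) ≤ 1 := (Int.fract_lt_one _).le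
    have h2 := abs_nbFluct_le x
    nlinarith [Int.fract_nonneg ((⌊1 / x⌋₊ : ℝ) / ((k : ℝ) + 1)), abs_nonneg (nbFluct x)]
  have hcongr : ∫ x in Set.Ioc (0 : ℝ) 1, nbRho k x * nbFluct x =
      ∫ x in Set.Ioc (0 : ℝ) 1, (1 / ((k : ℝ) + 1) * (Int.fract (1 / x) * nbFluct x) +
        Int.fract ((⌊1 / x⌋₊ : ℝ) / ((k : ℝ) + 1)) * nbFluct x) := by
    refine setIntegral_congr_fun measurableSet_Ioc fun x hx ↦ ?_
    rw [dilateFract_holds k x hx]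
    ring
  rw [hcongr, integral_add (i1.const_mul _) i2, integral_const_mul, rho1Fluct_holds, stepFluct_holds k, add_zero]
  field_simp

/-! ## K2 — the FIRST NORMAL EQUATION on Nyman's interval (route item `NbFirstNormalEquation`, PROVED):
row zero of the Gram matrix splits as `G_{0j} = G⁰_{0j} + 1/(j+1)` (on `(1,∞)`: `ρ_1 = 1/x`, `ρ_{j+1} = 1/((j+1)x)`). -/

/-- On `x > 1`: `ρ_{j+1}(x) = 1/((j+1)x)`. -/
lemma nbRho_eq_of_one_lt (j : ℕ) {x : ℝ} (hx : 1 < x) : nbRho j x = 1 / (((j : ℝ) + 1) * x) := by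
  have hx0 : 0 < x := by linarith
  have hk : (0 : ℝ) < (j : ℝ) + 1 := by positivity
  unfold nbRho
  rw [Int.fract_eq_self.2 ⟨by positivity, ?_⟩]
  rw [div_lt_one (by positivity)]
  nlinarith

/-- `ρ_{j+1} ρ_{k+1}` is integrable on `(0,1]`. -/
lemma integrableOn_nbRho_mul_nbRho_Ioc (j k : ℕ) :
    IntegrableOn (fun x ↦ nbRho j x * nbRho k x) (Set.Ioc (0 : ℝ) 1) :=
  integrableOn_Ioc_of_bounded ((measurable_nbRho j).mul (measurable_nbRho k)) (M := 1) fun x ↦ by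
    rw [abs_mul]
    exact mul_le_one₀ (abs_nbRho_le j x) (abs_nonneg _) (abs_nbRho_le k x)

/-- On `x > 1`: `ρ_1(x) ρ_{j+1}(x) = x⁻²/(j+1)`. -/
lemma nbRho_mul_nbRho_eq_of_one_lt (j : ℕ) {x : ℝ} (hx : 1 < x) :
    nbRho 0 x * nbRho j x = 1 / ((j : ℝ) + 1) * x ^ (-2 : ℝ) := by
  have hx0 : 0 < x := zero_lt_one.trans hx
  rw [nbRho_eq_of_one_lt 0 hx, nbRho_eq_of_one_lt j hx, Real.rpow_neg hx0.le, Real.rpow_two]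
  push_cast
  field_simp
  ring

/-- `ρ_1 ρ_{j+1}` is integrable on `(1,∞)`. -/
lemma integrableOn_nbRho_mul_nbRho_Ioi (j : ℕ) :
    IntegrableOn (fun x ↦ nbRho 0 x * nbRho j x) (Set.Ioi (1 : ℝ)) := by
  have h : IntegrableOn (fun x : ℝ ↦ 1 / ((j : ℝ) + 1) * x ^ (-2 : ℝ)) (Set.Ioi (1 : ℝ)) :=
    (integrableOn_Ioi_rpow_of_lt (by norm_num : (-2 : ℝ) < -1) zero_lt_one).const_mul _
  exact h.congr_fun (fun x hx ↦ (nbRho_mul_nbRho_eq_of_one_lt j hx).symm) measurableSet_Ioi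

/-- `∫_1^∞ ρ_1 ρ_{j+1} = 1/(j+1)`. -/
lemma integral_Ioi_nbRho_mul_nbRho (j : ℕ) :
    ∫ x in Set.Ioi (1 : ℝ), nbRho 0 x * nbRho j x = 1 / ((j : ℝ) + 1) := by
  rw [setIntegral_congr_fun measurableSet_Ioi (fun x hx ↦ nbRho_mul_nbRho_eq_of_one_lt j hx),
    integral_const_mul, integral_Ioi_rpow_of_lt (by norm_num) zero_lt_one]
  norm_num [Real.one_rpow]

/-- K2a: `G_{0j} = G⁰_{0j} + 1/(j+1)`. -/
theorem nbGram_zero_split (j : ℕ) :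
    nbGram 0 j = (∫ x in Set.Ioc (0 : ℝ) 1, nbRho 0 x * nbRho j x) + 1 / ((j : ℝ) + 1) := by
  unfold nbGram
  rw [← Set.Ioc_union_Ioi_eq_Ioi zero_le_one,
    setIntegral_union Set.Ioc_disjoint_Ioi_same measurableSet_Ioi (integrableOn_nbRho_mul_nbRho_Ioc 0 j)
      (integrableOn_nbRho_mul_nbRho_Ioi j),
    integral_Ioi_nbRho_mul_nbRho]

/-- K2b: on `(0,1]`, `∫ (χ − f_c)·{1/x} = b_0 − Σ_j c_j G⁰_{0j}`. -/
theorem integral_approx_mul_fract (N : ℕ) (cs : Fin N → ℝ) :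
    ∫ x in Set.Ioc (0 : ℝ) 1, approx cs x * Int.fract (1 / x) =
      nbRhs 0 - ∑ j : Fin N, cs j * ∫ x in Set.Ioc (0 : ℝ) 1, nbRho 0 x * nbRho j x := by
  have hcongr : ∫ x in Set.Ioc (0 : ℝ) 1, approx cs x * Int.fract (1 / x) =
      ∫ x in Set.Ioc (0 : ℝ) 1, (nbRho 0 x - ∑ j : Fin N, cs j * (nbRho 0 x * nbRho j x)) := by
    refine setIntegral_congr_fun measurableSet_Ioc fun x hx ↦ ?_
    have happ : approx cs x = 1 - ∑ k : Fin N, cs k * nbRho k x := by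
      simp [approx, nbRho, Set.indicator_of_mem hx]
    have h0 : Int.fract (1 / x) = nbRho 0 x := by simp [nbRho]
    rw [happ, h0, sub_mul, one_mul, Finset.sum_mul]
    congr 1
    exact Finset.sum_congr rfl fun k _ ↦ by ring
  have i0 : IntegrableOn (nbRho 0) (Set.Ioc (0 : ℝ) 1) :=
    integrableOn_Ioc_of_bounded (measurable_nbRho 0) (abs_nbRho_le 0)
  have iS : IntegrableOn (fun x ↦ ∑ j : Fin N, cs j * (nbRho 0 x * nbRho j x)) (Set.Ioc (0 : ℝ) 1) :=
    integrable_finsetSum _ fun (j : Fin N) _ ↦ (integrableOn_nbRho_mul_nbRho_Ioc 0 j).const_mul (cs j)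
  rw [hcongr, integral_sub i0 iS,
    integral_finsetSum _ (fun (j : Fin N) _ ↦ (integrableOn_nbRho_mul_nbRho_Ioc 0 j).const_mul (cs j))]
  simp only [integral_const_mul]
  rfl

/-- **Item `NbFirstNormalEquation` (crux): the first normal equation read on Nyman's interval, `∫_{(0,1]} (χ − f_c)·{1/x} = tailConst c`.** -/
theorem nbFirstNormalEquation_holds :
    (∀ (N : ℕ) (cs : Fin N → ℝ), 1 ≤ N →
    (∀ k : Fin N, ∑ j : Fin N,
        Summit.RiemannHypothesis.RiemannHypothesis.Theorems.NbTheory.nbGram k j * cs j =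
          Summit.RiemannHypothesis.RiemannHypothesis.Theorems.NbTheory.nbRhs k) →
      ∫ x in Set.Ioc (0 : ℝ) 1,
          Literature.NumberTheory.LFunctions.BaezDuarteOnlyIf.approx cs x * Int.fract (1 / x) =
        Literature.NumberTheory.LFunctions.BaezDuarteOnlyIf.tailConst cs) := by
  intro N cs hN hnormal
  have h0 : ∑ j : Fin N, nbGram 0 j * cs j = nbRhs 0 := hnormal ⟨0, hN⟩
  have h0' : ∑ j : Fin N, ((∫ x in Set.Ioc (0 : ℝ) 1, nbRho 0 x * nbRho j x) + 1 / ((j : ℕ) + 1 : ℝ)) * cs j =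
      nbRhs 0 := by
    rw [← h0]
    exact Finset.sum_congr rfl fun j _ ↦ by rw [nbGram_zero_split j]
  rw [integral_approx_mul_fract N cs, tailConst]
  have hsplit : ∑ j : Fin N, ((∫ x in Set.Ioc (0 : ℝ) 1, nbRho 0 x * nbRho j x) + 1 / ((j : ℕ) + 1 : ℝ)) * cs j =
      (∑ j : Fin N, cs j * ∫ x in Set.Ioc (0 : ℝ) 1, nbRho 0 x * nbRho j x) +
        ∑ j : Fin N, cs j / ((j : ℕ) + 1 : ℝ) := by
    rw [← Finset.sum_add_distrib]
    exact Finset.sum_congr rfl fun j _ ↦ by ring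
  linarith

/-! ## Assembly and the rung leaf -/

/-- **The Assembly item of route «NymanBeurlingTail» is provable now** (pure bookkeeping on `(0,1]`). -/
theorem assembly_proof :
    (∀ k : ℕ, ∫ x in Set.Ioc (0 : ℝ) 1,
      Summit.RiemannHypothesis.RiemannHypothesis.Theorems.NbTheory.nbRho k x *
        Summit.RiemannHypothesis.RiemannHypothesis.Theorems.NbTheory.nbFluct x =
    Summit.RiemannHypothesis.RiemannHypothesis.Theorems.NbTheory.nbQ / ((k : ℝ) + 1)) →
    (∀ (N : ℕ) (cs : Fin N → ℝ), 1 ≤ N →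
    (∀ k : Fin N, ∑ j : Fin N,
        Summit.RiemannHypothesis.RiemannHypothesis.Theorems.NbTheory.nbGram k j * cs j =
          Summit.RiemannHypothesis.RiemannHypothesis.Theorems.NbTheory.nbRhs k) →
      ∫ x in Set.Ioc (0 : ℝ) 1,
          Literature.NumberTheory.LFunctions.BaezDuarteOnlyIf.approx cs x * Int.fract (1 / x) =
        Literature.NumberTheory.LFunctions.BaezDuarteOnlyIf.tailConst cs) →
    (∀ w : ℕ → ℝ, (∃ B : ℝ, ∀ n, |w n| ≤ B) →
    ∫ x in Set.Ioc (0 : ℝ) 1,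
        w ⌊1 / x⌋₊ * Summit.RiemannHypothesis.RiemannHypothesis.Theorems.NbTheory.nbFluct x = 0) →
    (∫ x in Set.Ioc (0 : ℝ) 1, Summit.RiemannHypothesis.RiemannHypothesis.Theorems.NbTheory.nbStepH x =
    1 - Real.eulerMascheroniConstant) →
    NbTailConstIdentity := by
  intro h2 h3 h4 h5 N cs hN hnormal
  have e3 := h3 N cs hN hnormal
  -- rewrite the integrand of the first normal equation on (0,1]
  have hcongr : ∫ x in Set.Ioc (0 : ℝ) 1, approx cs x * Int.fract (1 / x) =
      ∫ x in Set.Ioc (0 : ℝ) 1, ((nbStepH x + nbFluct x) - (∑ k : Fin N, cs k * (nbRho k x * nbStepH x)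
        + ∑ k : Fin N, cs k * (nbRho k x * nbFluct x))) := by
    refine setIntegral_congr_fun measurableSet_Ioc fun x hx ↦ ?_
    have hfr : Int.fract (1 / x) = nbStepH x + nbFluct x := by
      simp [nbFluct, hx.1, hx.2]
    have happ : approx cs x = 1 - ∑ k : Fin N, cs k * nbRho k x := by
      simp [approx, nbRho, Set.indicator_of_mem hx]
    rw [happ, hfr, sub_mul, one_mul, Finset.sum_mul, ← Finset.sum_add_distrib]
    congr 1
    exact Finset.sum_congr rfl fun k _ ↦ by ring
  -- integrability of every piece
  have iH := integrableOn_nbStepH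
  have iQ := integrableOn_nbFluct
  have iS1 : IntegrableOn (fun x ↦ ∑ k : Fin N, cs k * (nbRho k x * nbStepH x)) (Set.Ioc (0 : ℝ) 1) :=
    integrable_finsetSum _ fun (k : Fin N) _ ↦ (integrableOn_nbRho_mul_nbStepH k).const_mul (cs k)
  have iS2 : IntegrableOn (fun x ↦ ∑ k : Fin N, cs k * (nbRho k x * nbFluct x)) (Set.Ioc (0 : ℝ) 1) :=
    integrable_finsetSum _ fun (k : Fin N) _ ↦ (integrableOn_nbRho_mul_nbFluct k).const_mul (cs k)
  have hsplit : ∫ x in Set.Ioc (0 : ℝ) 1, ((nbStepH x + nbFluct x) - (∑ k : Fin N, cs k * (nbRho k x * nbStepH x)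
        + ∑ k : Fin N, cs k * (nbRho k x * nbFluct x))) =
      ((∫ x in Set.Ioc (0 : ℝ) 1, nbStepH x) + ∫ x in Set.Ioc (0 : ℝ) 1, nbFluct x) -
        ((∑ k : Fin N, cs k * ∫ x in Set.Ioc (0 : ℝ) 1, nbRho k x * nbStepH x) +
          ∑ k : Fin N, cs k * ∫ x in Set.Ioc (0 : ℝ) 1, nbRho k x * nbFluct x) := by
    rw [integral_sub (f := fun x ↦ nbStepH x + nbFluct x)
      (g := fun x ↦ ∑ k : Fin N, cs k * (nbRho k x * nbStepH x) + ∑ k : Fin N, cs k * (nbRho k x * nbFluct x))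
      (iH.add iQ) (iS1.add iS2)]
    rw [integral_add iH iQ, integral_add iS1 iS2,
      integral_finsetSum _ (fun (k : Fin N) _ ↦ (integrableOn_nbRho_mul_nbStepH k).const_mul (cs k)),
      integral_finsetSum _ (fun (k : Fin N) _ ↦ (integrableOn_nbRho_mul_nbFluct k).const_mul (cs k))]
    simp only [integral_const_mul]
  rw [hcongr, hsplit] at e3
  -- the four evaluations
  have eH : ∫ x in Set.Ioc (0 : ℝ) 1, nbStepH x = 1 - Real.eulerMascheroniConstant := h5
  have eQ : ∫ x in Set.Ioc (0 : ℝ) 1, nbFluct x = 0 := by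
    have := h4 (fun _ ↦ 1) ⟨1, fun _ ↦ by simp⟩
    simpa using this
  have eK : ∀ k : Fin N, ∫ x in Set.Ioc (0 : ℝ) 1, nbRho k x * nbFluct x = nbQ / ((k : ℕ) + 1 : ℝ) :=
    fun k ↦ h2 k
  have eRH : ∀ k : Fin N, ∫ x in Set.Ioc (0 : ℝ) 1, nbRho k x * nbStepH x = nbRhoH k := fun k ↦ rfl
  simp only [eH, eQ, eK, eRH] at e3
  have htail : ∑ k : Fin N, cs k * (nbQ / ((k : ℕ) + 1 : ℝ)) = nbQ * tailConst cs := by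
    rw [tailConst, Finset.mul_sum]
    refine Finset.sum_congr rfl fun k _ ↦ ?_
    ring
  rw [htail] at e3
  linarith

/-- **THE RUNG LEAF L-P(P2) IS A THEOREM**: the tail-constant identity of the Nyman–Beurling minimiser,
RH-free for every `N` and every solution of the normal equations. -/
theorem nbTailConstIdentity_holds : NbTailConstIdentity :=
  assembly_proof nbKeyOrthogonality_holds nbFirstNormalEquation_holds nbFluctStepOrthogonal_holds
    nbCondExpIntegral_holds

end Summit.RiemannHypothesis.RiemannHypothesis.Theorems.NbTheory

end
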